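import Summits.NavierStokesRegularity.FluidComputer.RowScaleSound
import HarnessLib

/-!
# Soundness of the squaring chains and blocks of the row check against `RowModel.Cert`
# (`pub-fluidc-bp3/R1-DESIGN.md` §9.2 / §9.4, layer B of `structure Row`)

HONEST FRAMING (cell `pub-fluidc`, blueprint seat bp3, gen 20): low prior, high value-of-information
experiment on Tao's machine paradigm; NOT a claim that NS blows up. Real / integer bookkeeping only.

Continuing `RowScaleSound`: from the checks of `rowCheck` (+ `signsOK`) this file proves the chain
half of `RowModel.Cert` for the real views of the integer tables — `hAd0`, `hbd0`, `hAdsq`, `hbdsq`,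
`hAn0`, `hbn0`, `hAnsq`, `hbnsq`, `hAnI`, `hbnn` (the decayed chain `η E`, `η E g` and the no-decay
chain `E`, `E g` with `g ≥ h η' φ`, every squaring rounding the real products up), `hub`, `hsup`
(the `2^msub` blocks: `u ↦ A_dec u + b_dec`, running sup `A_nd u + b_nd < W̄`) — and bundles
everything with `RowScaleSound` in `chain_sound : rowPass = true → …` (20 conjuncts, in the shapes
`Cert` wants, with `S ↦ S - msub`, `nb ↦ 2^msub`).

[cite: Tao2016AveragedNS, §5.5 Thm 5.3 (5.5)]
-/

namespace Summit.NavierStokesRegularity.FluidComputer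

open Literature.Analysis.FluidPDE.FluidComputer
open Literature.Analysis.ValidatedNumerics.Numerics (cdiv div_le_cdiv le_cdiv_mul_real)

namespace RowCheck

open DIVec ChainField Finset Real

namespace RowData

variable {r : RowData}

/-! ### The two squaring chains -/

/-- The decayed chain, one more squaring. [folklore] -/
theorem dec_succ (n : ℕ) : r.dec (n + 1) = sqStep r.P (r.dec n) := squarings_succ _ _ _

/-- The no-decay chain, one more squaring. [folklore] -/
theorem nd_succ (n : ℕ) : r.nd (n + 1) = sqStep r.P (r.nd n) := squarings_succ _ _ _

/-- `Cert.hAdsq` (every `n`). [folklore] -/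
theorem AdR_sq (n : ℕ) (i k : Fin 8) : ∑ j, r.AdR n i j * r.AdR n j k ≤ r.AdR (n + 1) i k := by
  simp only [AdR, dec_succ, sqStep]
  exact toR_mmUp _ _ _ _

/-- `Cert.hbdsq` (every `n`). [folklore] -/
theorem bdR_sq (n : ℕ) (i : Fin 8) :
    ∑ j, r.AdR n i j * r.bdR n j + r.bdR n i ≤ r.bdR (n + 1) i := by
  simp only [AdR, bdR, dec_succ, sqStep, Vec.get_mk', toR_add]
  exact add_le_add (toR_mvUp (r := r) (r.dec n).1 (r.dec n).2 i) le_rfl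

/-- `Cert.hAnsq` (every `n`). [folklore] -/
theorem AnR_sq (n : ℕ) (i k : Fin 8) : ∑ j, r.AnR n i j * r.AnR n j k ≤ r.AnR (n + 1) i k := by
  simp only [AnR, nd_succ, sqStep]
  exact toR_mmUp _ _ _ _

/-- `Cert.hbnsq` (every `n`). [folklore] -/
theorem bnR_sq (n : ℕ) (i : Fin 8) :
    ∑ j, r.AnR n i j * r.bnR n j + r.bnR n i ≤ r.bnR (n + 1) i := by
  simp only [AnR, bnR, nd_succ, sqStep, Vec.get_mk', toR_add]
  exact add_le_add (toR_mvUp (r := r) (r.nd n).1 (r.nd n).2 i) le_rfl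

/-- `Cert.hAn0` (with equality). [folklore] -/
theorem AnR_zero (i k : Fin 8) : r.AnR 0 i k = r.ER i k := by
  simp [AnR, ER, nd, RowData.squarings, Et]

/-- `g ≥ h η' φ`. [folklore] -/
theorem gR_ge (h : r.rowCheck.hOK = true) (hn : r.signsOK = true) (k : Fin 8) :
    r.hR * (r.etapR * r.phiR k) ≤ r.toR (r.g'.get k) := by
  simp only [g', Vec.get_mk']
  calc r.hR * (r.etapR * r.phiR k) ≤ r.hR * r.toR (cdiv (r.etap' * r.phi'.get k) (one r.P)) :=
        mul_le_mul_of_nonneg_left (toR_mul_le _ _) (hR_pos h hn).le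
    _ ≤ _ := toR_mul_le _ _

/-- `E g ≥ E (h η' φ)`. [folklore] -/
theorem EgR_ge (h : r.rowCheck.hOK = true) (hn : r.signsOK = true) (i : Fin 8) :
    ∑ k, r.ER i k * (r.hR * (r.etapR * r.phiR k)) ≤ r.toR (r.Eg'.get i) := by
  calc ∑ k, r.ER i k * (r.hR * (r.etapR * r.phiR k)) ≤ ∑ k, r.ER i k * r.toR (r.g'.get k) :=
        sum_le_sum fun k _ => mul_le_mul_of_nonneg_left (gR_ge h hn k) (ER_nonneg hn i k)
    _ ≤ r.toR (r.Eg'.get i) := by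
        have := toR_mvUp (r := r) r.Et r.g' i
        simp only [Et, Tab.at_mk'] at this
        exact this

/-- `Cert.hbn0`. [folklore] -/
theorem bnR_zero_ge (h : r.rowCheck.hOK = true) (hn : r.signsOK = true) (i : Fin 8) :
    ∑ k, r.ER i k * (r.hR * (r.etapR * r.phiR k)) ≤ r.bnR 0 i := by
  have := EgR_ge h hn i
  simpa [bnR, nd, RowData.squarings] using this

/-- `0 ≤ η`. [folklore] -/
theorem etaR_nonneg (h : r.rowCheck.hOK = true) (hn : r.signsOK = true) : 0 ≤ r.etaR :=
  (exp_pos _).le.trans (eta_sound h hn)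

/-- `0 ≤ η'`. [folklore] -/
theorem etapR_nonneg (h : r.rowCheck.hOK = true) (hn : r.signsOK = true)
    (hc : r.rowCheck.chOK = true) : 0 ≤ r.etapR :=
  (exp_pos _).le.trans (etap_sound h hn hc)

/-- `Cert.hAd0`. [folklore] -/
theorem AdR_zero_ge (i k : Fin 8) : r.etaR * r.ER i k ≤ r.AdR 0 i k := by
  have := toR_mul_le (r := r) r.eta' (r.E i k)
  simpa [AdR, dec, RowData.squarings, Adec0, Et, etaR, ER] using this

/-- `Cert.hbd0`. [folklore] -/
theorem bdR_zero_ge (h : r.rowCheck.hOK = true) (hn : r.signsOK = true) (i : Fin 8) :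
    r.etaR * ∑ k, r.ER i k * (r.hR * (r.etapR * r.phiR k)) ≤ r.bdR 0 i := by
  calc r.etaR * ∑ k, r.ER i k * (r.hR * (r.etapR * r.phiR k)) ≤ r.etaR * r.toR (r.Eg'.get i) :=
        mul_le_mul_of_nonneg_left (EgR_ge h hn i) (etaR_nonneg h hn)
    _ ≤ r.bdR 0 i := by
        have := toR_mul_le (r := r) r.eta' (r.Eg'.get i)
        simpa [bdR, dec, RowData.squarings, bdec0, etaR] using this

/-- `Cert.hAnI` (every `n`): the no-decay chain dominates the identity. [folklore] -/
theorem AnR_ge_one (he : r.rowCheck.eOK = true) (h : r.rowCheck.hOK = true)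
    (hn : r.signsOK = true) : ∀ (n : ℕ) (i k : Fin 8),
    (if i = k then (1 : ℝ) else 0) ≤ r.AnR n i k := by
  intro n
  induction n with
  | zero =>
    intro i k
    rw [AnR_zero]
    have h1 := hIE_sound he i k
    have h2 : 0 ≤ r.hR * ∑ j, r.BR i j * r.ER j k :=
      mul_nonneg (hR_pos h hn).le
        (sum_nonneg fun j _ => mul_nonneg (BR_nonneg i j) (ER_nonneg hn j k))
    linarith
  | succ n ih =>
    intro i k
    have h0 : ∀ a b, 0 ≤ r.AnR n a b := fun a b => le_trans (by split_ifs <;> norm_num) (ih a b)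
    have hkk : 1 ≤ r.AnR n k k := by simpa using ih k k
    calc (if i = k then (1 : ℝ) else 0) ≤ r.AnR n i k := ih i k
      _ ≤ r.AnR n i k * r.AnR n k k := le_mul_of_one_le_right (h0 i k) hkk
      _ ≤ ∑ j, r.AnR n i j * r.AnR n j k :=
          single_le_sum (f := fun j => r.AnR n i j * r.AnR n j k)
            (fun j _ => mul_nonneg (h0 i j) (h0 j k)) (mem_univ k)
      _ ≤ r.AnR (n + 1) i k := AnR_sq n i k

/-- `Cert.hbnn` (every `n`). [folklore] -/
theorem bnR_nonneg (he : r.rowCheck.eOK = true) (h : r.rowCheck.hOK = true)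
    (hn : r.signsOK = true) (hc : r.rowCheck.chOK = true) :
    ∀ (n : ℕ) (i : Fin 8), 0 ≤ r.bnR n i := by
  intro n
  induction n with
  | zero =>
    intro i
    refine le_trans (sum_nonneg fun k _ => ?_) (bnR_zero_ge h hn i)
    exact mul_nonneg (ER_nonneg hn i k) (mul_nonneg (hR_pos h hn).le
      (mul_nonneg (etapR_nonneg h hn hc) (phiR_nonneg hn k)))
  | succ n ih =>
    intro i
    refine le_trans ?_ (bnR_sq n i)
    have h0 : ∀ a b, 0 ≤ r.AnR n a b := fun a b =>
      le_trans (by split_ifs <;> norm_num) (AnR_ge_one he h hn n a b)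
    exact add_nonneg (sum_nonneg fun j _ => mul_nonneg (h0 i j) (ih j)) (ih i)

/-! ### The blocks -/

/-- One more block. [folklore] -/
theorem us_succ (j : ℕ) : r.us (j + 1) =
    blStep r.P (r.nd (r.S - r.msub)).1 (r.nd (r.S - r.msub)).2 (r.dec (r.S - r.msub)).1
      (r.dec (r.S - r.msub)).2 (r.us j) := blocks_succ _ _ _ _ _ _ _

/-- `d` more blocks. [folklore] -/
theorem us_add (m d : ℕ) : r.us (m + d) =
    RowData.blocks r.P (r.nd (r.S - r.msub)).1 (r.nd (r.S - r.msub)).2 (r.dec (r.S - r.msub)).1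
      (r.dec (r.S - r.msub)).2 d (r.us m) := blocks_add _ _ _ _ _ _ _ _

/-- `Cert.hub` (every `j`). [folklore] -/
theorem ubR_step (j : ℕ) (i : Fin 8) :
    ∑ k, r.AdR (r.S - r.msub) i k * r.ubR j k + r.bdR (r.S - r.msub) i ≤ r.ubR (j + 1) i := by
  simp only [ubR, us_succ, blStep, Vec.get_mk', toR_add, AdR, bdR]
  exact add_le_add (toR_mvUp (r := r) (r.dec (r.S - r.msub)).1 (r.us j).1 i) le_rfl

/-- `Cert.hsup`. [folklore] -/
theorem sup_lt (hw : r.rowCheck.wOK = true) (j : ℕ) (hj : j < 2 ^ r.msub) (i : Fin 8) :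
    ∑ k, r.AnR (r.S - r.msub) i k * r.ubR j k + r.bnR (r.S - r.msub) i < r.WbarR i := by
  have h1 : ∑ k, r.AnR (r.S - r.msub) i k * r.ubR j k + r.bnR (r.S - r.msub) i ≤
      r.toR ((r.us (j + 1)).2.get i) := by
    simp only [us_succ, blStep, Vec.get_mk', AnR, ubR, bnR]
    refine le_trans ?_ (toR_mono (le_max_right _ _))
    rw [toR_add]
    exact add_le_add (toR_mvUp (r := r) (r.nd (r.S - r.msub)).1 (r.us j).1 i) le_rfl
  have h2 : r.toR ((r.us (j + 1)).2.get i) ≤ r.toR ((r.us (2 ^ r.msub)).2.get i) := by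
    obtain ⟨d, hd⟩ := Nat.exists_eq_add_of_le (Nat.succ_le_of_lt hj)
    have e := us_add (r := r) (j + 1) d
    rw [hd, show j.succ + d = j + 1 + d from rfl, e]
    exact toR_mono (blocks_sup_mono _ _ _ _ _ _ _ _)
  have h3 : r.toR ((r.us (2 ^ r.msub)).2.get i) < r.WbarR i := toR_lt ((wOK_iff.mp hw) i)
  linarith

/-! ### Bundle: the chain half of `Cert` from `rowPass` -/

/-- The flags a passing row carries. [folklore] -/
theorem flags_of_rowPass (hok : r.rowPass = true) :
    r.rowCheck.hOK = true ∧ r.rowCheck.eOK = true ∧ r.rowCheck.chOK = true ∧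
      r.signsOK = true ∧ r.rowCheck.wOK = true := by
  simp only [rowPass, rowOK, Out.ok, Bool.and_eq_true] at hok
  tauto

/-- CHAIN SOUNDNESS. If the row passes, the real views of its integer tables satisfy the chain
half of `RowModel.Cert` — `hh`, `hc`, `hB0`, `hφ0`, `hE0`, `hIE`, `hη`, `hη'`, `hAd0`, `hbd0`,
`hAdsq`, `hbdsq`, `hAn0`, `hbn0`, `hAnsq`, `hbnsq`, `hAnI`, `hbnn`, `hub`, `hsup` — with
`S ↦ S - msub` squarings and `nb ↦ 2^msub` blocks (and the squaring / block inequalities for every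
index, not only below `S`, `nb`).
[cite: Tao2016AveragedNS, §5.5 Thm 5.3 (5.5)] -/
theorem chain_sound (hok : r.rowPass = true) :
    0 < r.hR ∧ 0 ≤ r.cR ∧ (∀ i j, 0 ≤ r.BR i j) ∧ (∀ i, 0 ≤ r.phiR i) ∧ (∀ i k, 0 ≤ r.ER i k) ∧
    (∀ i k, (if i = k then (1 : ℝ) else 0) ≤ r.ER i k - r.hR * ∑ j, r.BR i j * r.ER j k) ∧
    exp (-(r.cR * r.hR)) ≤ r.etaR ∧ exp (r.cR * r.hR) ≤ r.etapR ∧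
    (∀ i k, r.etaR * r.ER i k ≤ r.AdR 0 i k) ∧
    (∀ i, r.etaR * ∑ k, r.ER i k * (r.hR * (r.etapR * r.phiR k)) ≤ r.bdR 0 i) ∧
    (∀ n i k, ∑ j, r.AdR n i j * r.AdR n j k ≤ r.AdR (n + 1) i k) ∧
    (∀ n i, ∑ j, r.AdR n i j * r.bdR n j + r.bdR n i ≤ r.bdR (n + 1) i) ∧
    (∀ i k, r.ER i k ≤ r.AnR 0 i k) ∧
    (∀ i, ∑ k, r.ER i k * (r.hR * (r.etapR * r.phiR k)) ≤ r.bnR 0 i) ∧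
    (∀ n i k, ∑ j, r.AnR n i j * r.AnR n j k ≤ r.AnR (n + 1) i k) ∧
    (∀ n i, ∑ j, r.AnR n i j * r.bnR n j + r.bnR n i ≤ r.bnR (n + 1) i) ∧
    (∀ n i k, (if i = k then (1 : ℝ) else 0) ≤ r.AnR n i k) ∧ (∀ n i, 0 ≤ r.bnR n i) ∧
    (∀ j i, ∑ k, r.AdR (r.S - r.msub) i k * r.ubR j k + r.bdR (r.S - r.msub) i ≤ r.ubR (j + 1) i) ∧
    (∀ j < 2 ^ r.msub, ∀ i,
      ∑ k, r.AnR (r.S - r.msub) i k * r.ubR j k + r.bnR (r.S - r.msub) i < r.WbarR i) := by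
  obtain ⟨h, he, hc, hn, hw⟩ := flags_of_rowPass hok
  exact ⟨hR_pos h hn, cR_nonneg, BR_nonneg, phiR_nonneg hn, ER_nonneg hn, hIE_sound he,
    eta_sound h hn, etap_sound h hn hc, AdR_zero_ge, bdR_zero_ge h hn, AdR_sq, bdR_sq,
    fun i k => (AnR_zero i k).ge, bnR_zero_ge h hn, AnR_sq, bnR_sq, AnR_ge_one he h hn,
    bnR_nonneg he h hn hc, ubR_step, sup_lt hw⟩

end RowData

end RowCheck

end Summit.NavierStokesRegularity.FluidComputer
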